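import Summits.QuantumFields.BalabanUV.Beta.GAN24.FourFaceGaugeSectors

/-!
# `BalabanUV.Beta.GAN24.FourFaceGaugeSectorsOnePair` — binder row G-an2-4 ∕ (CONV-C), row (C) at the levels `j ≥ 1`, CONTACT side; Part 5 of
# `GAN24/FourFaceGaugeSectors`: **THE SIX ONE-PAIR CLASSES AND THE ALL-DISTINCT CLASS OF THE SECTOR EXPANSION** — when exactly two of the four slots face the
# same direction (the other two facing two further, distinct directions) the four-face charge is the cell charge plus THAT PAIR's pure-gauge sector, every other
# sector being lonely; when all four directions are distinct it is the cell charge (my g52 `fourFace_mul_eq_zmode_of_pairwise_ne` under the weaker ff-covariance)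

NOT IN PRINT; OUR BOOKKEEPING (G-an2-4 crux team (2), leaf prover `b2b-balaban-gan24-formalise-leaf-02`, gen 64).  WHY.  (C)sym's binder ranges over ALL patterns
`(μ,ν;α,β)`; Part 2 evaluated the three two-pair classes (the Wilson-charged ones); Part 3's `fourFace_mul_eq_sum_live` gives every class in restricted form; this file
spells out the seven classes with at most one coincidence, for the (C)_j assembler's `obtain`.  [folklore] `decide` (the lonely members) + Part 1's `sector_eq_zero_of_lonely`
+ `Finset.sum_subset`; generic `d`, `1 ≤ N`, `Y` as in Part 1; 0 `def`, 0 cited facts, 0 `def … : Prop`, 0 sorry.  HONEST FRAMING (cell contract,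
verbatim): «discharging `BetaPertH` makes Bałaban's UV stability UNCONDITIONAL — a real constructive-QFT result; it is NOT the continuum limit and NOT the Clay problem.»
HONEST DEPENDENCY (verbatim): «continuum YM on T⁴ ⇐ BetaPertH ∧ nine spine estimates (0/9 proved); BetaPertH ⇐ (D1) ∧ (D4) ∧ CAP+tail; G-an2-4 gates asym, D1 and NE2/3/4.»
Bookkeeping only: NO Ward content; discharges NOTHING of (C) ∕ (C)sym ∕ (Q-L) ∕ «T2Shape» ∕ «T2Drift» ∕ (hW, hWall); NEVER «G-an2-4 closed» as (CONV-C); NOT D1, NOT BetaPertH,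
NOT continuum, NOT Clay.  2026-08-23.
-/

noncomputable section

open Finset
open scoped BigOperators
open Literature.MathematicalPhysics.QuantumFieldTheory
open Literature.MathematicalPhysics.QuantumFieldTheory.Balaban1983to89
open Literature.MathematicalPhysics.QuantumFieldTheory.Balaban1983to89.Beta
open ExpKernelCalculus (MKer shiftK)
open OneStepResolventKernel (Fib)
open AffineAveraging (Site box toSite)
open BalabanCompositeJets (LocStencil₂)
open Summit.QuantumFields.BalabanUV.Beta.GAN24.BiStencilZeroMode (Tab zmode)
open Summit.QuantumFields.BalabanUV.Beta.GAN24.FourFaceGaugeSectors (fourFace_mul_eq_sum_sectors sector_empty sector_eq_zero_of_lonely)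

namespace Summit.QuantumFields.BalabanUV.Beta.GAN24.FourFaceGaugeSectorsOnePair

variable {d : ℕ} {N : ℕ}

/-! ## §0 Restricting a sum over all subsets to a family outside which the terms vanish -/

/-- [folklore] For any finite type `ι`: a sum over all subsets of `ι` equals the sum over any family `T` outside which the summand vanishes (`Finset.sum_subset`). -/
theorem sum_powerset_univ_eq_sum_of_vanish {ι : Type*} [Fintype ι] [DecidableEq ι] (f : Finset ι → ℝ) (T : Finset (Finset ι))
    (hf : ∀ S, S ∉ T → f S = 0) : ∑ S ∈ (Finset.univ : Finset ι).powerset, f S = ∑ S ∈ T, f S :=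
  (Finset.sum_subset (fun S _ => Finset.mem_powerset.2 (Finset.subset_univ S)) fun S _ hS => hf S hS).symm

/-! ## §1 The six one-pair classes: `N⁴·FF = zmode + Sector_{pair}` -/

/-- [folklore] The lonely members of the one-pair class `0, 0, 1, 2`: outside `{∅, {0, 1}}` every subset of the four slots has a member alone in its class. -/
theorem lonely_of_pair_01 : ∀ S : Finset (Fin 4), S ∉ ({∅, {0, 1}} : Finset (Finset (Fin 4))) →
    ∃ s₀ ∈ S, ∀ s ∈ S, (![0, 0, 1, 2] : Fin 4 → Fin 3) s = (![0, 0, 1, 2] : Fin 4 → Fin 3) s₀ → s = s₀ := by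
  decide

/-- [folklore] In the class `(κ,κ;a,b)` (`κ, a, b` pairwise distinct) two slots face the same direction iff they have the same class label. -/
theorem class_of_dir_pair_01 {κ a b : Fin (d + 1)} (hκa : κ ≠ a) (hκb : κ ≠ b) (hab : a ≠ b) (s s₀ : Fin 4)
    (h : (![κ, κ, a, b] : Fin 4 → Fin (d + 1)) s = (![κ, κ, a, b] : Fin 4 → Fin (d + 1)) s₀) :
    (![0, 0, 1, 2] : Fin 4 → Fin 3) s = (![0, 0, 1, 2] : Fin 4 → Fin 3) s₀ := by
  fin_cases s <;> fin_cases s₀ <;> simp [hκa, hκa.symm, hκb, hκb.symm, hab, hab.symm] at h ⊢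

/-- NOT IN PRINT; OUR BOOKKEEPING.  **THE ONE-PAIR CLASS `(κ,κ;a,b)`** (`κ, a, b` pairwise distinct; `Y` as in Part 1): `N⁴·FF_N(Y)(κ,κ;a,b) = zmode N Y κ κ (inl α) (inl β) + Sector_{{0, 1}}(Y)`
— the coincident pair's pure-gauge sector is the only survivor besides the cell charge. -/
theorem fourFace_mul_eq_of_pair_01 (hN : 1 ≤ N) {Y : Tab d} {C δ : ℝ} (hY : LocStencil₂ Y C δ) (hδ : 0 < δ)
    (h1 : ∀ κ u κ' u' (t x z : Site (d + 1)) (α β : Fin (d + 1)),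
      Y κ (u + t) κ' (u' + t) x z (Sum.inl α) (Sum.inl β) = shiftK (-t) (Y κ u κ' u') x z (Sum.inl α) (Sum.inl β))
    {κ a b : Fin (d + 1)} (hκa : κ ≠ a) (hκb : κ ≠ b) (hab : a ≠ b) (α β : Fin (d + 1)) :
    (N : ℝ) ^ 4 * ∑ rr ∈ box (d + 1) N, ∑' u' : Site (d + 1), ∑' x : Site (d + 1), ∑' z : Site (d + 1),
        (if toSite rr κ % (N : ℤ) = (N : ℤ) - 1 ∧ u' κ % (N : ℤ) = (N : ℤ) - 1 ∧ x a % (N : ℤ) = (N : ℤ) - 1 ∧ z b % (N : ℤ) = (N : ℤ) - 1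
          then Y κ (toSite rr) κ u' x z (Sum.inl α) (Sum.inl β) else 0)
      = zmode N Y κ κ (Sum.inl α) (Sum.inl β)
        + ∑ rr ∈ box (d + 1) N, ∑' u' : Site (d + 1), ∑' x : Site (d + 1), ∑' z : Site (d + 1),
            (∏ s ∈ ({0, 1} : Finset (Fin 4)), (1 - (N : ℝ) * (if (![toSite rr, u', x, z] : Fin 4 → Site (d + 1)) s ((![κ, κ, a, b] : Fin 4 → Fin (d + 1)) s) % (N : ℤ) = (N : ℤ) - 1
              then (1 : ℝ) else 0))) * Y κ (toSite rr) κ u' x z (Sum.inl α) (Sum.inl β) := by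
  rw [fourFace_mul_eq_sum_sectors hN hY hδ h1 κ κ a b α β,
    sum_powerset_univ_eq_sum_of_vanish _ ({∅, {0, 1}} : Finset (Finset (Fin 4))) ?van]
  · rw [Finset.sum_insert (by decide), Finset.sum_singleton, sector_empty]
    have c2 : (({0, 1} : Finset (Fin 4)).card : ℕ) = 2 := by decide
    rw [Finset.card_empty, c2, pow_zero, neg_one_sq]
    simp only [one_mul]
  · intro S hS
    obtain ⟨s₀, hs₀, hl⟩ := lonely_of_pair_01 S hS
    rw [sector_eq_zero_of_lonely hN hY hδ h1 κ κ a b α β S hs₀ (fun s hs h => hl s hs (class_of_dir_pair_01 hκa hκb hab s s₀ h)), mul_zero]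

/-- [folklore] The lonely members of the one-pair class `0, 1, 0, 2`: outside `{∅, {0, 2}}` every subset of the four slots has a member alone in its class. -/
theorem lonely_of_pair_02 : ∀ S : Finset (Fin 4), S ∉ ({∅, {0, 2}} : Finset (Finset (Fin 4))) →
    ∃ s₀ ∈ S, ∀ s ∈ S, (![0, 1, 0, 2] : Fin 4 → Fin 3) s = (![0, 1, 0, 2] : Fin 4 → Fin 3) s₀ → s = s₀ := by
  decide

/-- [folklore] In the class `(κ,a;κ,b)` (`κ, a, b` pairwise distinct) two slots face the same direction iff they have the same class label. -/
theorem class_of_dir_pair_02 {κ a b : Fin (d + 1)} (hκa : κ ≠ a) (hκb : κ ≠ b) (hab : a ≠ b) (s s₀ : Fin 4)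
    (h : (![κ, a, κ, b] : Fin 4 → Fin (d + 1)) s = (![κ, a, κ, b] : Fin 4 → Fin (d + 1)) s₀) :
    (![0, 1, 0, 2] : Fin 4 → Fin 3) s = (![0, 1, 0, 2] : Fin 4 → Fin 3) s₀ := by
  fin_cases s <;> fin_cases s₀ <;> simp [hκa, hκa.symm, hκb, hκb.symm, hab, hab.symm] at h ⊢

/-- NOT IN PRINT; OUR BOOKKEEPING.  **THE ONE-PAIR CLASS `(κ,a;κ,b)`** (`κ, a, b` pairwise distinct; `Y` as in Part 1): `N⁴·FF_N(Y)(κ,a;κ,b) = zmode N Y κ a (inl α) (inl β) + Sector_{{0, 2}}(Y)`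
— the coincident pair's pure-gauge sector is the only survivor besides the cell charge. -/
theorem fourFace_mul_eq_of_pair_02 (hN : 1 ≤ N) {Y : Tab d} {C δ : ℝ} (hY : LocStencil₂ Y C δ) (hδ : 0 < δ)
    (h1 : ∀ κ u κ' u' (t x z : Site (d + 1)) (α β : Fin (d + 1)),
      Y κ (u + t) κ' (u' + t) x z (Sum.inl α) (Sum.inl β) = shiftK (-t) (Y κ u κ' u') x z (Sum.inl α) (Sum.inl β))
    {κ a b : Fin (d + 1)} (hκa : κ ≠ a) (hκb : κ ≠ b) (hab : a ≠ b) (α β : Fin (d + 1)) :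
    (N : ℝ) ^ 4 * ∑ rr ∈ box (d + 1) N, ∑' u' : Site (d + 1), ∑' x : Site (d + 1), ∑' z : Site (d + 1),
        (if toSite rr κ % (N : ℤ) = (N : ℤ) - 1 ∧ u' a % (N : ℤ) = (N : ℤ) - 1 ∧ x κ % (N : ℤ) = (N : ℤ) - 1 ∧ z b % (N : ℤ) = (N : ℤ) - 1
          then Y κ (toSite rr) a u' x z (Sum.inl α) (Sum.inl β) else 0)
      = zmode N Y κ a (Sum.inl α) (Sum.inl β)
        + ∑ rr ∈ box (d + 1) N, ∑' u' : Site (d + 1), ∑' x : Site (d + 1), ∑' z : Site (d + 1),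
            (∏ s ∈ ({0, 2} : Finset (Fin 4)), (1 - (N : ℝ) * (if (![toSite rr, u', x, z] : Fin 4 → Site (d + 1)) s ((![κ, a, κ, b] : Fin 4 → Fin (d + 1)) s) % (N : ℤ) = (N : ℤ) - 1
              then (1 : ℝ) else 0))) * Y κ (toSite rr) a u' x z (Sum.inl α) (Sum.inl β) := by
  rw [fourFace_mul_eq_sum_sectors hN hY hδ h1 κ a κ b α β,
    sum_powerset_univ_eq_sum_of_vanish _ ({∅, {0, 2}} : Finset (Finset (Fin 4))) ?van]
  · rw [Finset.sum_insert (by decide), Finset.sum_singleton, sector_empty]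
    have c2 : (({0, 2} : Finset (Fin 4)).card : ℕ) = 2 := by decide
    rw [Finset.card_empty, c2, pow_zero, neg_one_sq]
    simp only [one_mul]
  · intro S hS
    obtain ⟨s₀, hs₀, hl⟩ := lonely_of_pair_02 S hS
    rw [sector_eq_zero_of_lonely hN hY hδ h1 κ a κ b α β S hs₀ (fun s hs h => hl s hs (class_of_dir_pair_02 hκa hκb hab s s₀ h)), mul_zero]

/-- [folklore] The lonely members of the one-pair class `0, 1, 2, 0`: outside `{∅, {0, 3}}` every subset of the four slots has a member alone in its class. -/
theorem lonely_of_pair_03 : ∀ S : Finset (Fin 4), S ∉ ({∅, {0, 3}} : Finset (Finset (Fin 4))) →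
    ∃ s₀ ∈ S, ∀ s ∈ S, (![0, 1, 2, 0] : Fin 4 → Fin 3) s = (![0, 1, 2, 0] : Fin 4 → Fin 3) s₀ → s = s₀ := by
  decide

/-- [folklore] In the class `(κ,a;b,κ)` (`κ, a, b` pairwise distinct) two slots face the same direction iff they have the same class label. -/
theorem class_of_dir_pair_03 {κ a b : Fin (d + 1)} (hκa : κ ≠ a) (hκb : κ ≠ b) (hab : a ≠ b) (s s₀ : Fin 4)
    (h : (![κ, a, b, κ] : Fin 4 → Fin (d + 1)) s = (![κ, a, b, κ] : Fin 4 → Fin (d + 1)) s₀) :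
    (![0, 1, 2, 0] : Fin 4 → Fin 3) s = (![0, 1, 2, 0] : Fin 4 → Fin 3) s₀ := by
  fin_cases s <;> fin_cases s₀ <;> simp [hκa, hκa.symm, hκb, hκb.symm, hab, hab.symm] at h ⊢

/-- NOT IN PRINT; OUR BOOKKEEPING.  **THE ONE-PAIR CLASS `(κ,a;b,κ)`** (`κ, a, b` pairwise distinct; `Y` as in Part 1): `N⁴·FF_N(Y)(κ,a;b,κ) = zmode N Y κ a (inl α) (inl β) + Sector_{{0, 3}}(Y)`
— the coincident pair's pure-gauge sector is the only survivor besides the cell charge. -/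
theorem fourFace_mul_eq_of_pair_03 (hN : 1 ≤ N) {Y : Tab d} {C δ : ℝ} (hY : LocStencil₂ Y C δ) (hδ : 0 < δ)
    (h1 : ∀ κ u κ' u' (t x z : Site (d + 1)) (α β : Fin (d + 1)),
      Y κ (u + t) κ' (u' + t) x z (Sum.inl α) (Sum.inl β) = shiftK (-t) (Y κ u κ' u') x z (Sum.inl α) (Sum.inl β))
    {κ a b : Fin (d + 1)} (hκa : κ ≠ a) (hκb : κ ≠ b) (hab : a ≠ b) (α β : Fin (d + 1)) :
    (N : ℝ) ^ 4 * ∑ rr ∈ box (d + 1) N, ∑' u' : Site (d + 1), ∑' x : Site (d + 1), ∑' z : Site (d + 1),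
        (if toSite rr κ % (N : ℤ) = (N : ℤ) - 1 ∧ u' a % (N : ℤ) = (N : ℤ) - 1 ∧ x b % (N : ℤ) = (N : ℤ) - 1 ∧ z κ % (N : ℤ) = (N : ℤ) - 1
          then Y κ (toSite rr) a u' x z (Sum.inl α) (Sum.inl β) else 0)
      = zmode N Y κ a (Sum.inl α) (Sum.inl β)
        + ∑ rr ∈ box (d + 1) N, ∑' u' : Site (d + 1), ∑' x : Site (d + 1), ∑' z : Site (d + 1),
            (∏ s ∈ ({0, 3} : Finset (Fin 4)), (1 - (N : ℝ) * (if (![toSite rr, u', x, z] : Fin 4 → Site (d + 1)) s ((![κ, a, b, κ] : Fin 4 → Fin (d + 1)) s) % (N : ℤ) = (N : ℤ) - 1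
              then (1 : ℝ) else 0))) * Y κ (toSite rr) a u' x z (Sum.inl α) (Sum.inl β) := by
  rw [fourFace_mul_eq_sum_sectors hN hY hδ h1 κ a b κ α β,
    sum_powerset_univ_eq_sum_of_vanish _ ({∅, {0, 3}} : Finset (Finset (Fin 4))) ?van]
  · rw [Finset.sum_insert (by decide), Finset.sum_singleton, sector_empty]
    have c2 : (({0, 3} : Finset (Fin 4)).card : ℕ) = 2 := by decide
    rw [Finset.card_empty, c2, pow_zero, neg_one_sq]
    simp only [one_mul]
  · intro S hS
    obtain ⟨s₀, hs₀, hl⟩ := lonely_of_pair_03 S hS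
    rw [sector_eq_zero_of_lonely hN hY hδ h1 κ a b κ α β S hs₀ (fun s hs h => hl s hs (class_of_dir_pair_03 hκa hκb hab s s₀ h)), mul_zero]

/-- [folklore] The lonely members of the one-pair class `1, 0, 0, 2`: outside `{∅, {1, 2}}` every subset of the four slots has a member alone in its class. -/
theorem lonely_of_pair_12 : ∀ S : Finset (Fin 4), S ∉ ({∅, {1, 2}} : Finset (Finset (Fin 4))) →
    ∃ s₀ ∈ S, ∀ s ∈ S, (![1, 0, 0, 2] : Fin 4 → Fin 3) s = (![1, 0, 0, 2] : Fin 4 → Fin 3) s₀ → s = s₀ := by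
  decide

/-- [folklore] In the class `(a,κ;κ,b)` (`κ, a, b` pairwise distinct) two slots face the same direction iff they have the same class label. -/
theorem class_of_dir_pair_12 {κ a b : Fin (d + 1)} (hκa : κ ≠ a) (hκb : κ ≠ b) (hab : a ≠ b) (s s₀ : Fin 4)
    (h : (![a, κ, κ, b] : Fin 4 → Fin (d + 1)) s = (![a, κ, κ, b] : Fin 4 → Fin (d + 1)) s₀) :
    (![1, 0, 0, 2] : Fin 4 → Fin 3) s = (![1, 0, 0, 2] : Fin 4 → Fin 3) s₀ := by
  fin_cases s <;> fin_cases s₀ <;> simp [hκa, hκa.symm, hκb, hκb.symm, hab, hab.symm] at h ⊢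

/-- NOT IN PRINT; OUR BOOKKEEPING.  **THE ONE-PAIR CLASS `(a,κ;κ,b)`** (`κ, a, b` pairwise distinct; `Y` as in Part 1): `N⁴·FF_N(Y)(a,κ;κ,b) = zmode N Y a κ (inl α) (inl β) + Sector_{{1, 2}}(Y)`
— the coincident pair's pure-gauge sector is the only survivor besides the cell charge. -/
theorem fourFace_mul_eq_of_pair_12 (hN : 1 ≤ N) {Y : Tab d} {C δ : ℝ} (hY : LocStencil₂ Y C δ) (hδ : 0 < δ)
    (h1 : ∀ κ u κ' u' (t x z : Site (d + 1)) (α β : Fin (d + 1)),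
      Y κ (u + t) κ' (u' + t) x z (Sum.inl α) (Sum.inl β) = shiftK (-t) (Y κ u κ' u') x z (Sum.inl α) (Sum.inl β))
    {κ a b : Fin (d + 1)} (hκa : κ ≠ a) (hκb : κ ≠ b) (hab : a ≠ b) (α β : Fin (d + 1)) :
    (N : ℝ) ^ 4 * ∑ rr ∈ box (d + 1) N, ∑' u' : Site (d + 1), ∑' x : Site (d + 1), ∑' z : Site (d + 1),
        (if toSite rr a % (N : ℤ) = (N : ℤ) - 1 ∧ u' κ % (N : ℤ) = (N : ℤ) - 1 ∧ x κ % (N : ℤ) = (N : ℤ) - 1 ∧ z b % (N : ℤ) = (N : ℤ) - 1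
          then Y a (toSite rr) κ u' x z (Sum.inl α) (Sum.inl β) else 0)
      = zmode N Y a κ (Sum.inl α) (Sum.inl β)
        + ∑ rr ∈ box (d + 1) N, ∑' u' : Site (d + 1), ∑' x : Site (d + 1), ∑' z : Site (d + 1),
            (∏ s ∈ ({1, 2} : Finset (Fin 4)), (1 - (N : ℝ) * (if (![toSite rr, u', x, z] : Fin 4 → Site (d + 1)) s ((![a, κ, κ, b] : Fin 4 → Fin (d + 1)) s) % (N : ℤ) = (N : ℤ) - 1
              then (1 : ℝ) else 0))) * Y a (toSite rr) κ u' x z (Sum.inl α) (Sum.inl β) := by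
  rw [fourFace_mul_eq_sum_sectors hN hY hδ h1 a κ κ b α β,
    sum_powerset_univ_eq_sum_of_vanish _ ({∅, {1, 2}} : Finset (Finset (Fin 4))) ?van]
  · rw [Finset.sum_insert (by decide), Finset.sum_singleton, sector_empty]
    have c2 : (({1, 2} : Finset (Fin 4)).card : ℕ) = 2 := by decide
    rw [Finset.card_empty, c2, pow_zero, neg_one_sq]
    simp only [one_mul]
  · intro S hS
    obtain ⟨s₀, hs₀, hl⟩ := lonely_of_pair_12 S hS
    rw [sector_eq_zero_of_lonely hN hY hδ h1 a κ κ b α β S hs₀ (fun s hs h => hl s hs (class_of_dir_pair_12 hκa hκb hab s s₀ h)), mul_zero]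

/-- [folklore] The lonely members of the one-pair class `1, 0, 2, 0`: outside `{∅, {1, 3}}` every subset of the four slots has a member alone in its class. -/
theorem lonely_of_pair_13 : ∀ S : Finset (Fin 4), S ∉ ({∅, {1, 3}} : Finset (Finset (Fin 4))) →
    ∃ s₀ ∈ S, ∀ s ∈ S, (![1, 0, 2, 0] : Fin 4 → Fin 3) s = (![1, 0, 2, 0] : Fin 4 → Fin 3) s₀ → s = s₀ := by
  decide

/-- [folklore] In the class `(a,κ;b,κ)` (`κ, a, b` pairwise distinct) two slots face the same direction iff they have the same class label. -/
theorem class_of_dir_pair_13 {κ a b : Fin (d + 1)} (hκa : κ ≠ a) (hκb : κ ≠ b) (hab : a ≠ b) (s s₀ : Fin 4)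
    (h : (![a, κ, b, κ] : Fin 4 → Fin (d + 1)) s = (![a, κ, b, κ] : Fin 4 → Fin (d + 1)) s₀) :
    (![1, 0, 2, 0] : Fin 4 → Fin 3) s = (![1, 0, 2, 0] : Fin 4 → Fin 3) s₀ := by
  fin_cases s <;> fin_cases s₀ <;> simp [hκa, hκa.symm, hκb, hκb.symm, hab, hab.symm] at h ⊢

/-- NOT IN PRINT; OUR BOOKKEEPING.  **THE ONE-PAIR CLASS `(a,κ;b,κ)`** (`κ, a, b` pairwise distinct; `Y` as in Part 1): `N⁴·FF_N(Y)(a,κ;b,κ) = zmode N Y a κ (inl α) (inl β) + Sector_{{1, 3}}(Y)`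
— the coincident pair's pure-gauge sector is the only survivor besides the cell charge. -/
theorem fourFace_mul_eq_of_pair_13 (hN : 1 ≤ N) {Y : Tab d} {C δ : ℝ} (hY : LocStencil₂ Y C δ) (hδ : 0 < δ)
    (h1 : ∀ κ u κ' u' (t x z : Site (d + 1)) (α β : Fin (d + 1)),
      Y κ (u + t) κ' (u' + t) x z (Sum.inl α) (Sum.inl β) = shiftK (-t) (Y κ u κ' u') x z (Sum.inl α) (Sum.inl β))
    {κ a b : Fin (d + 1)} (hκa : κ ≠ a) (hκb : κ ≠ b) (hab : a ≠ b) (α β : Fin (d + 1)) :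
    (N : ℝ) ^ 4 * ∑ rr ∈ box (d + 1) N, ∑' u' : Site (d + 1), ∑' x : Site (d + 1), ∑' z : Site (d + 1),
        (if toSite rr a % (N : ℤ) = (N : ℤ) - 1 ∧ u' κ % (N : ℤ) = (N : ℤ) - 1 ∧ x b % (N : ℤ) = (N : ℤ) - 1 ∧ z κ % (N : ℤ) = (N : ℤ) - 1
          then Y a (toSite rr) κ u' x z (Sum.inl α) (Sum.inl β) else 0)
      = zmode N Y a κ (Sum.inl α) (Sum.inl β)
        + ∑ rr ∈ box (d + 1) N, ∑' u' : Site (d + 1), ∑' x : Site (d + 1), ∑' z : Site (d + 1),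
            (∏ s ∈ ({1, 3} : Finset (Fin 4)), (1 - (N : ℝ) * (if (![toSite rr, u', x, z] : Fin 4 → Site (d + 1)) s ((![a, κ, b, κ] : Fin 4 → Fin (d + 1)) s) % (N : ℤ) = (N : ℤ) - 1
              then (1 : ℝ) else 0))) * Y a (toSite rr) κ u' x z (Sum.inl α) (Sum.inl β) := by
  rw [fourFace_mul_eq_sum_sectors hN hY hδ h1 a κ b κ α β,
    sum_powerset_univ_eq_sum_of_vanish _ ({∅, {1, 3}} : Finset (Finset (Fin 4))) ?van]
  · rw [Finset.sum_insert (by decide), Finset.sum_singleton, sector_empty]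
    have c2 : (({1, 3} : Finset (Fin 4)).card : ℕ) = 2 := by decide
    rw [Finset.card_empty, c2, pow_zero, neg_one_sq]
    simp only [one_mul]
  · intro S hS
    obtain ⟨s₀, hs₀, hl⟩ := lonely_of_pair_13 S hS
    rw [sector_eq_zero_of_lonely hN hY hδ h1 a κ b κ α β S hs₀ (fun s hs h => hl s hs (class_of_dir_pair_13 hκa hκb hab s s₀ h)), mul_zero]

/-- [folklore] The lonely members of the one-pair class `1, 2, 0, 0`: outside `{∅, {2, 3}}` every subset of the four slots has a member alone in its class. -/
theorem lonely_of_pair_23 : ∀ S : Finset (Fin 4), S ∉ ({∅, {2, 3}} : Finset (Finset (Fin 4))) →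
    ∃ s₀ ∈ S, ∀ s ∈ S, (![1, 2, 0, 0] : Fin 4 → Fin 3) s = (![1, 2, 0, 0] : Fin 4 → Fin 3) s₀ → s = s₀ := by
  decide

/-- [folklore] In the class `(a,b;κ,κ)` (`κ, a, b` pairwise distinct) two slots face the same direction iff they have the same class label. -/
theorem class_of_dir_pair_23 {κ a b : Fin (d + 1)} (hκa : κ ≠ a) (hκb : κ ≠ b) (hab : a ≠ b) (s s₀ : Fin 4)
    (h : (![a, b, κ, κ] : Fin 4 → Fin (d + 1)) s = (![a, b, κ, κ] : Fin 4 → Fin (d + 1)) s₀) :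
    (![1, 2, 0, 0] : Fin 4 → Fin 3) s = (![1, 2, 0, 0] : Fin 4 → Fin 3) s₀ := by
  fin_cases s <;> fin_cases s₀ <;> simp [hκa, hκa.symm, hκb, hκb.symm, hab, hab.symm] at h ⊢

/-- NOT IN PRINT; OUR BOOKKEEPING.  **THE ONE-PAIR CLASS `(a,b;κ,κ)`** (`κ, a, b` pairwise distinct; `Y` as in Part 1): `N⁴·FF_N(Y)(a,b;κ,κ) = zmode N Y a b (inl α) (inl β) + Sector_{{2, 3}}(Y)`
— the coincident pair's pure-gauge sector is the only survivor besides the cell charge. -/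
theorem fourFace_mul_eq_of_pair_23 (hN : 1 ≤ N) {Y : Tab d} {C δ : ℝ} (hY : LocStencil₂ Y C δ) (hδ : 0 < δ)
    (h1 : ∀ κ u κ' u' (t x z : Site (d + 1)) (α β : Fin (d + 1)),
      Y κ (u + t) κ' (u' + t) x z (Sum.inl α) (Sum.inl β) = shiftK (-t) (Y κ u κ' u') x z (Sum.inl α) (Sum.inl β))
    {κ a b : Fin (d + 1)} (hκa : κ ≠ a) (hκb : κ ≠ b) (hab : a ≠ b) (α β : Fin (d + 1)) :
    (N : ℝ) ^ 4 * ∑ rr ∈ box (d + 1) N, ∑' u' : Site (d + 1), ∑' x : Site (d + 1), ∑' z : Site (d + 1),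
        (if toSite rr a % (N : ℤ) = (N : ℤ) - 1 ∧ u' b % (N : ℤ) = (N : ℤ) - 1 ∧ x κ % (N : ℤ) = (N : ℤ) - 1 ∧ z κ % (N : ℤ) = (N : ℤ) - 1
          then Y a (toSite rr) b u' x z (Sum.inl α) (Sum.inl β) else 0)
      = zmode N Y a b (Sum.inl α) (Sum.inl β)
        + ∑ rr ∈ box (d + 1) N, ∑' u' : Site (d + 1), ∑' x : Site (d + 1), ∑' z : Site (d + 1),
            (∏ s ∈ ({2, 3} : Finset (Fin 4)), (1 - (N : ℝ) * (if (![toSite rr, u', x, z] : Fin 4 → Site (d + 1)) s ((![a, b, κ, κ] : Fin 4 → Fin (d + 1)) s) % (N : ℤ) = (N : ℤ) - 1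
              then (1 : ℝ) else 0))) * Y a (toSite rr) b u' x z (Sum.inl α) (Sum.inl β) := by
  rw [fourFace_mul_eq_sum_sectors hN hY hδ h1 a b κ κ α β,
    sum_powerset_univ_eq_sum_of_vanish _ ({∅, {2, 3}} : Finset (Finset (Fin 4))) ?van]
  · rw [Finset.sum_insert (by decide), Finset.sum_singleton, sector_empty]
    have c2 : (({2, 3} : Finset (Fin 4)).card : ℕ) = 2 := by decide
    rw [Finset.card_empty, c2, pow_zero, neg_one_sq]
    simp only [one_mul]
  · intro S hS
    obtain ⟨s₀, hs₀, hl⟩ := lonely_of_pair_23 S hS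
    rw [sector_eq_zero_of_lonely hN hY hδ h1 a b κ κ α β S hs₀ (fun s hs h => hl s hs (class_of_dir_pair_23 hκa hκb hab s s₀ h)), mul_zero]

/-! ## §2 The all-distinct class: `N⁴·FF = zmode` (under the ff-covariance) -/

/-- [folklore] With four pairwise distinct class labels every non-empty subset of the four slots has a lonely member. -/
theorem lonely_of_distinct : ∀ S : Finset (Fin 4), S ∉ ({∅} : Finset (Finset (Fin 4))) →
    ∃ s₀ ∈ S, ∀ s ∈ S, (![0, 1, 2, 3] : Fin 4 → Fin 4) s = (![0, 1, 2, 3] : Fin 4 → Fin 4) s₀ → s = s₀ := by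
  decide

/-- [folklore] With `κ κ′ a b` pairwise distinct two slots face the same direction iff they are the same slot. -/
theorem class_of_dir_distinct {κ κ' a b : Fin (d + 1)} (hκκ' : κ ≠ κ') (hκa : κ ≠ a) (hκb : κ ≠ b) (hκ'a : κ' ≠ a) (hκ'b : κ' ≠ b) (hab : a ≠ b)
    (s s₀ : Fin 4) (h : (![κ, κ', a, b] : Fin 4 → Fin (d + 1)) s = (![κ, κ', a, b] : Fin 4 → Fin (d + 1)) s₀) :
    (![0, 1, 2, 3] : Fin 4 → Fin 4) s = (![0, 1, 2, 3] : Fin 4 → Fin 4) s₀ := by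
  fin_cases s <;> fin_cases s₀ <;>
    simp [hκκ', hκκ'.symm, hκa, hκa.symm, hκb, hκb.symm, hκ'a, hκ'a.symm, hκ'b, hκ'b.symm, hab, hab.symm] at h ⊢

/-- NOT IN PRINT; OUR BOOKKEEPING.  **THE ALL-DISTINCT CLASS** (`κ κ′ a b` pairwise distinct; `Y` as in Part 1): `N⁴·FF_N(Y)(κ,κ′;a,b) = zmode N Y κ κ′ (inl α) (inl β)` — every
pure-gauge sector is lonely (my g52 `FourFaceOneCov.fourFace_mul_eq_zmode_of_pairwise_ne`, now under the weaker ff-covariance hypothesis and from the sector expansion). -/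
theorem fourFace_mul_eq_zmode_of_distinct (hN : 1 ≤ N) {Y : Tab d} {C δ : ℝ} (hY : LocStencil₂ Y C δ) (hδ : 0 < δ)
    (h1 : ∀ κ u κ' u' (t x z : Site (d + 1)) (α β : Fin (d + 1)),
      Y κ (u + t) κ' (u' + t) x z (Sum.inl α) (Sum.inl β) = shiftK (-t) (Y κ u κ' u') x z (Sum.inl α) (Sum.inl β))
    {κ κ' a b : Fin (d + 1)} (hκκ' : κ ≠ κ') (hκa : κ ≠ a) (hκb : κ ≠ b) (hκ'a : κ' ≠ a) (hκ'b : κ' ≠ b) (hab : a ≠ b) (α β : Fin (d + 1)) :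
    (N : ℝ) ^ 4 * ∑ rr ∈ box (d + 1) N, ∑' u' : Site (d + 1), ∑' x : Site (d + 1), ∑' z : Site (d + 1),
        (if toSite rr κ % (N : ℤ) = (N : ℤ) - 1 ∧ u' κ' % (N : ℤ) = (N : ℤ) - 1 ∧ x a % (N : ℤ) = (N : ℤ) - 1 ∧ z b % (N : ℤ) = (N : ℤ) - 1
          then Y κ (toSite rr) κ' u' x z (Sum.inl α) (Sum.inl β) else 0)
      = zmode N Y κ κ' (Sum.inl α) (Sum.inl β) := by
  rw [fourFace_mul_eq_sum_sectors hN hY hδ h1 κ κ' a b α β,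
    sum_powerset_univ_eq_sum_of_vanish _ ({∅} : Finset (Finset (Fin 4))) ?van]
  · rw [Finset.sum_singleton, sector_empty, Finset.card_empty, pow_zero, one_mul]
  · intro S hS
    obtain ⟨s₀, hs₀, hl⟩ := lonely_of_distinct S hS
    rw [sector_eq_zero_of_lonely hN hY hδ h1 κ κ' a b α β S hs₀
      (fun s hs h => hl s hs (class_of_dir_distinct hκκ' hκa hκb hκ'a hκ'b hab s s₀ h)), mul_zero]

end Summit.QuantumFields.BalabanUV.Beta.GAN24.FourFaceGaugeSectorsOnePair
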